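import Mathlib.Topology.Order.IntermediateValue
import Mathlib.Topology.Order.Monotone
import Mathlib.Topology.Order.Compact
import Mathlib.Topology.Instances.Real.Lemmas
import Mathlib.Topology.UniformSpace.HeineCantor
import Mathlib.Topology.MetricSpace.Pseudo.Constructions

/-!
# Crux `PerpetualPump.AveragedTypeIBlowup` (stmt-NavierStokesRegularity-1835), line `Sketch`:
# stub `hittingTime` — strict first crossings of a level persist continuously in a parameter

This file proves the registered stub `stub_hittingTime` of the line skeleton
`Cruxes/AveragedTypeIBlowup/Lines/Sketch.lean` (G6, Mathlib-only). Data: a real function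
`F A t` of a parameter `A` and a time `t`, jointly continuous on the rectangle
`[A₀ - δ, A₀ + δ] × [a, T + δ]`, such that the slice `F A₀ ·` stays strictly below the level `c`
on `[a, T)`, equals `c` at `T` and is strictly above `c` on `(T, T + δ]` (a STRICT first crossing
at `T`). Conclusion: for every `e > 0` there is `d > 0` such that every parameter `A` with
`|A - A₀| < d` has a first hitting time `T'` of the level `c` (that is, `F A T' = c` and `F A < c` on
`[a, T')`) with `|T' - T| < e` and `T' ∈ (a, T + δ]`. In the skeleton this makes the cut-off times
`T_k(A)` (the first time the cumulative transfer of the `k`-th bond reaches `1`) depend continuously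
on the datum amplitude `A`, as needed for the renormalised amplitudes fed to `stub_ivtNesting`.

Proof (pure real analysis, Mathlib only). Put `e' := min (min e δ) (T - a) / 2`.
* `hittingTime_exists_first_eq` — first passage: if `f` is continuous on `[a, b]`, `f < y` on
  `[a, m]` (`a ≤ m ≤ b`) and `y ≤ f b`, then the infimum `c` of the closed set
  `{x ∈ [a, b] | y ≤ f x}` lies in `(m, b]`, satisfies `f c = y` (intermediate value theorem) and
  `f < y` on `[a, c)`.
* `hittingTime_uniform_near` — Heine–Cantor on the compact rectangle: nearby slices `F A ·` are
  uniformly `κ`-close to `F A₀ ·` on `[a, b]`.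
* `stub_hittingTime` — the maximum `M` of `F A₀` on `[a, T - e']` is `< c` (extreme value theorem)
  and `c < F A₀ (T + e')`; with `κ := min (c - M) (F A₀ (T + e') - c) / 2` every `κ`-close slice is
  `< c` on `[a, T - e']` and `> c` at `T + e'`, so its first passage through `c` lies in
  `(T - e', T + e']`.

## References

* T. Tao, *Finite time blowup for an averaged three-dimensional Navier–Stokes equation*, J. Amer.
  Math. Soc. 29 (2016), 601–674, §5 (the continuity-in-the-amplitude bookkeeping is folklore).
-/

noncomputable section

-- the summit namespace `…NavierStokesRegularity.NavierStokesRegularity…` is the tree convention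
set_option linter.dupNamespace false

open Set Filter Topology

namespace Summit.NavierStokesRegularity.NavierStokesRegularity.Theorems.PerpetualPumpAveragedTypeIBlowup

/-- **First passage through a level after a barrier.** If `f` is continuous on `[a, b]`, `f x < y`
for all `x ∈ [a, m]` (where `a ≤ m ≤ b`) and `y ≤ f b`, then there is `c ∈ (m, b]` with `f c = y`
and `f x < y` for all `x ∈ [a, c)` (namely the infimum of the closed set `{x ∈ [a, b] | y ≤ f x}`).
[folklore] -/
theorem hittingTime_exists_first_eq {f : ℝ → ℝ} {a m b y : ℝ} (ham : a ≤ m) (hmb : m ≤ b)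
    (hf : ContinuousOn f (Icc a b)) (hlow : ∀ x ∈ Icc a m, f x < y) (hb : y ≤ f b) :
    ∃ c ∈ Ioc m b, f c = y ∧ ∀ x ∈ Ico a c, f x < y := by
  set S : Set ℝ := Icc a b ∩ f ⁻¹' (Ici y) with hS
  have hab : a ≤ b := ham.trans hmb
  have hSc : IsClosed S := hf.preimage_isClosed_of_isClosed isClosed_Icc isClosed_Ici
  have hbS : b ∈ S := ⟨right_mem_Icc.2 hab, hb⟩
  have hSne : S.Nonempty := ⟨b, hbS⟩
  have hSbdd : BddBelow S := ⟨a, fun x hx => hx.1.1⟩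
  have hcS : sInf S ∈ S := hSc.csInf_mem hSne hSbdd
  have hcab : sInf S ∈ Icc a b := hcS.1
  have hyc : y ≤ f (sInf S) := hcS.2
  have hleft : ∀ x ∈ Ico a (sInf S), f x < y := by
    intro x hx
    by_contra hxy
    have hxS : x ∈ S := ⟨⟨hx.1, hx.2.le.trans hcab.2⟩, not_lt.1 hxy⟩
    exact (not_le.2 hx.2) (csInf_le hSbdd hxS)
  have hmc : m < sInf S := by
    by_contra hle
    exact (hlow (sInf S) ⟨hcab.1, not_lt.1 hle⟩).not_ge hyc
  refine ⟨sInf S, ⟨hmc, hcab.2⟩, ?_, hleft⟩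
  have hfc : ContinuousOn f (Icc a (sInf S)) := hf.mono (Icc_subset_Icc_right hcab.2)
  have ha : f a ≤ y := (hlow a (left_mem_Icc.2 ham)).le
  obtain ⟨d, hd, hfd⟩ := intermediate_value_Icc hcab.1 hfc ⟨ha, hyc⟩
  have hdS : d ∈ S := ⟨⟨hd.1, hd.2.trans hcab.2⟩, hfd.ge⟩
  have hdc : d = sInf S := le_antisymm hd.2 (csInf_le hSbdd hdS)
  rw [← hdc]
  exact hfd

/-- **Slices of a jointly continuous function are continuous.** If `F` is jointly continuous on
`[A₀ - δ, A₀ + δ] × [a, b]` and `A ∈ [A₀ - δ, A₀ + δ]`, then `t ↦ F A t` is continuous on `[a, b]`.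
[folklore] -/
theorem hittingTime_slice_continuousOn {F : ℝ → ℝ → ℝ} {A₀ δ a b A : ℝ}
    (hF : ContinuousOn (Function.uncurry F) (Icc (A₀ - δ) (A₀ + δ) ×ˢ Icc a b))
    (hA : A ∈ Icc (A₀ - δ) (A₀ + δ)) : ContinuousOn (fun t => F A t) (Icc a b) := by
  have h : ContinuousOn (Function.uncurry F ∘ fun t : ℝ => (A, t)) (Icc a b) :=
    hF.comp (continuousOn_const.prodMk continuousOn_id) fun _ ht => ⟨hA, ht⟩
  exact h

/-- **Nearby slices are uniformly close.** If `F` is jointly continuous on the compact rectangle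
`[A₀ - δ, A₀ + δ] × [a, b]` (`0 < δ`), then for every `κ > 0` there is `d ∈ (0, δ]` such that
`|F A t - F A₀ t| < κ` whenever `|A - A₀| < d` and `t ∈ [a, b]` (Heine–Cantor). [folklore] -/
theorem hittingTime_uniform_near {F : ℝ → ℝ → ℝ} {A₀ δ a b κ : ℝ} (hδ : 0 < δ) (hκ : 0 < κ)
    (hF : ContinuousOn (Function.uncurry F) (Icc (A₀ - δ) (A₀ + δ) ×ˢ Icc a b)) :
    ∃ d : ℝ, 0 < d ∧ d ≤ δ ∧ ∀ A : ℝ, |A - A₀| < d → ∀ t ∈ Icc a b, |F A t - F A₀ t| < κ := by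
  have hK : IsCompact (Icc (A₀ - δ) (A₀ + δ) ×ˢ Icc a b) := isCompact_Icc.prod isCompact_Icc
  obtain ⟨d₀, hd₀, hd₀F⟩ :=
    Metric.uniformContinuousOn_iff.1 (hK.uniformContinuousOn_of_continuous hF) κ hκ
  refine ⟨min d₀ δ, lt_min hd₀ hδ, min_le_right _ _, fun A hA t ht => ?_⟩
  have hAd₀ : |A - A₀| < d₀ := hA.trans_le (min_le_left _ _)
  have hAδ : |A - A₀| < δ := hA.trans_le (min_le_right _ _)
  have hAI : A ∈ Icc (A₀ - δ) (A₀ + δ) := by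
    rw [abs_lt] at hAδ
    constructor <;> linarith [hAδ.1, hAδ.2]
  have hA₀I : A₀ ∈ Icc (A₀ - δ) (A₀ + δ) := ⟨by linarith, by linarith⟩
  have h := hd₀F (A, t) ⟨hAI, ht⟩ (A₀, t) ⟨hA₀I, ht⟩
    (by rwa [dist_prod_same_right, Real.dist_eq])
  rw [Real.dist_eq] at h
  exact h

/-- **Stub `hittingTime`** (G6, Mathlib-only). STRICT FIRST CROSSINGS PERSIST: if `F(A₀,·)` stays
below the level `c` on `[a,T)`, hits it at `T` and exceeds it right after, and `F` is jointly
continuous on a rectangle, then every nearby parameter `A` has a first hitting time of `c`, as close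
to `T` as desired. Used for the cut-off times `T_k(A)` (first time the cumulative transfer `∫ R w²`
of the `k`-th bond reaches `1`) in the definition of the renormalised amplitudes fed to
`stub_ivtNesting`. [folklore] -/
theorem stub_hittingTime :
    ∀ (F : ℝ → ℝ → ℝ) (A₀ a T δ c : ℝ), a < T → 0 < δ →
      ContinuousOn (Function.uncurry F) (Icc (A₀ - δ) (A₀ + δ) ×ˢ Icc a (T + δ)) →
      (∀ t ∈ Ico a T, F A₀ t < c) → F A₀ T = c → (∀ t ∈ Ioc T (T + δ), c < F A₀ t) →
      ∀ e : ℝ, 0 < e → ∃ d : ℝ, 0 < d ∧ ∀ A : ℝ, |A - A₀| < d →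
        ∃ T' : ℝ, |T' - T| < e ∧ T' ∈ Ioc a (T + δ) ∧ F A T' = c ∧ ∀ t ∈ Ico a T', F A t < c := by
  intro F A₀ a T δ c haT hδ hF hlt _hT hgt e he
  -- half-width of the time window around `T`
  obtain ⟨e', he'pos, he'e, he'δ, he'a⟩ :
      ∃ e' : ℝ, 0 < e' ∧ e' < e ∧ e' < δ ∧ a ≤ T - e' := by
    have hμe : min (min e δ) (T - a) ≤ e := (min_le_left _ _).trans (min_le_left _ _)
    have hμδ : min (min e δ) (T - a) ≤ δ := (min_le_left _ _).trans (min_le_right _ _)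
    have hμa : min (min e δ) (T - a) ≤ T - a := min_le_right _ _
    have hμ : 0 < min (min e δ) (T - a) := lt_min (lt_min he hδ) (sub_pos.2 haT)
    exact ⟨min (min e δ) (T - a) / 2, by linarith, by linarith, by linarith, by linarith⟩
  -- (i) the reference slice is strictly above `c` at `T + e'`
  have hplus : c < F A₀ (T + e') := hgt (T + e') ⟨by linarith, by linarith⟩
  -- (ii) the reference slice has a maximum `< c` on `[a, T - e']`
  have hA₀I : A₀ ∈ Icc (A₀ - δ) (A₀ + δ) := ⟨by linarith, by linarith⟩
  have hFA₀ : ContinuousOn (fun t => F A₀ t) (Icc a (T + δ)) :=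
    hittingTime_slice_continuousOn hF hA₀I
  obtain ⟨t₀, ht₀, hmax⟩ := (isCompact_Icc : IsCompact (Icc a (T - e'))).exists_isMaxOn
    (nonempty_Icc.2 he'a) (hFA₀.mono (Icc_subset_Icc_right (by linarith)))
  have hM : F A₀ t₀ < c := hlt t₀ ⟨ht₀.1, by linarith [ht₀.2]⟩
  -- the margin `κ`
  obtain ⟨κ, hκ, hκM, hκp⟩ :
      ∃ κ : ℝ, 0 < κ ∧ F A₀ t₀ + κ < c ∧ c < F A₀ (T + e') - κ := by
    have h1 : min (c - F A₀ t₀) (F A₀ (T + e') - c) ≤ c - F A₀ t₀ := min_le_left _ _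
    have h2 : min (c - F A₀ t₀) (F A₀ (T + e') - c) ≤ F A₀ (T + e') - c := min_le_right _ _
    have h0 : 0 < min (c - F A₀ t₀) (F A₀ (T + e') - c) :=
      lt_min (sub_pos.2 hM) (sub_pos.2 hplus)
    exact ⟨min (c - F A₀ t₀) (F A₀ (T + e') - c) / 2, by linarith, by linarith, by linarith⟩
  -- (iii) uniform closeness of nearby slices
  obtain ⟨d, hd, hdδ, hclose⟩ := hittingTime_uniform_near (a := a) (b := T + δ) hδ hκ hF
  refine ⟨d, hd, fun A hA => ?_⟩
  -- (iv) the slice at `A` is `< c` on `[a, T - e']`, `> c` at `T + e'`: first passage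
  have hAδ : |A - A₀| < δ := hA.trans_le hdδ
  have hAI : A ∈ Icc (A₀ - δ) (A₀ + δ) := by
    rw [abs_lt] at hAδ
    constructor <;> linarith [hAδ.1, hAδ.2]
  have hFA : ContinuousOn (fun t => F A t) (Icc a (T + e')) :=
    (hittingTime_slice_continuousOn hF hAI).mono (Icc_subset_Icc_right (by linarith))
  have hlowA : ∀ t ∈ Icc a (T - e'), F A t < c := by
    intro t ht
    have h1 : F A₀ t ≤ F A₀ t₀ := isMaxOn_iff.1 hmax t ht
    have h2 : |F A t - F A₀ t| < κ := hclose A hA t ⟨ht.1, by linarith [ht.2]⟩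
    rw [abs_sub_lt_iff] at h2
    linarith [h2.1]
  have hbA : c ≤ F A (T + e') := by
    have h2 : |F A (T + e') - F A₀ (T + e')| < κ :=
      hclose A hA (T + e') ⟨by linarith, by linarith⟩
    rw [abs_sub_lt_iff] at h2
    linarith [h2.2]
  obtain ⟨T', hT', hFT', hbefore⟩ :=
    hittingTime_exists_first_eq he'a (by linarith) hFA hlowA hbA
  refine ⟨T', ?_, ⟨lt_of_le_of_lt he'a hT'.1, by linarith [hT'.2]⟩, hFT', hbefore⟩
  rw [abs_sub_lt_iff]
  constructor <;> linarith [hT'.1, hT'.2]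

end Summit.NavierStokesRegularity.NavierStokesRegularity.Theorems.PerpetualPumpAveragedTypeIBlowup

end
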